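import Literature.AlgebraicGeometry.HodgeTheory.LefschetzOneOneChernWeil
import Literature.Geometry.Kaehler.ManifoldFormsPullback
import Literature.Geometry.Kaehler.PluriharmonicLog
import Literature.Geometry.Kaehler.LocalForms
import HarnessLib

/-!
# Lefschetz `(1,1)`, Chern–Weil leaf: the Chern form is exact where the bundle is trivial (proof)

Family `hodge`, layer `Literature/AlgebraicGeometry/HodgeTheory`. Discharge of the named fact
`Literature.AlgebraicGeometry.HodgeTheory.chernForm_exact_of_isTrivialOn` of
`LefschetzOneOneChernWeil.lean` (Voisin (2002), proof of Thm. 7.10: on an open set over which `L`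
is trivialised by a non-vanishing holomorphic section, "`ω_{L,h|U} = dβ`"; proof of Thm. 11.33:
"the Chern class `c₁(L_i)` vanishes on `X − D_i`, since `L_i` is trivial on `X − D_i`", and
"`∂∂̄ log h = ∂∂̄ log h(σ)`").

## The proof (Voisin (2002), §3.3.1 and proof of Thm. 7.10)

Let `s = (s_i)` be the non-vanishing holomorphic section of `L` over the open set `W`
(`IsTrivialOn`: `s_j = g_ij s_i`, holomorphic and non-zero on `U_i ∩ W`). Its squared length
`H := h(s) = h_i |s_i|²` is a well-defined positive function on `W` (`h_i = |g_ij|² h_j`); we realise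
it as a function `Fn` on `M` through a chosen frame index at each point (values off `W` are junk and
never used) and put `u = log H`, `ζ = (1/4π) (du) ∘ J` — a `1`-form on `M`, smooth at the points of
`W` — and `η := ζ|_W`, its restriction to the open submanifold `W`
(`Literature/Geometry/Kaehler/ManifoldFormsPullback`: restriction preserves smoothness and
commutes with `d`). On `U_j ∩ W`, `u = log h_j + log |s_j|²`, so
`dζ = (1/4π) d((d log h_j) ∘ J) + (1/4π) d((d log |s_j|²) ∘ J)`; the first term is the local Chern
form `ω_j = θ` (`IsChernForm`) and the second VANISHES because `log |s_j|²` is pluriharmonic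
(`Literature/Geometry/Kaehler/PluriharmonicLog`: "`∂∂̄ log |g|² = 0`" for `g` holomorphic
invertible, §3.3.1). Hence `dη = (dζ)|_W = θ|_W`. (Voisin's primitive is `(1/2iπ) ∂̄ log H`; ours,
`(1/4π)(d log H) ∘ J = (i/4π)(∂ - ∂̄) log H`, differs from it by the exact form `(i/4π) d log H`.)

## References

* C. Voisin, *Hodge Theory and Complex Algebraic Geometry I* (CUP 2002), §3.3.1, Thm. 7.10
  (proof), Thm. 11.33 (proof).
-/

noncomputable section

open scoped Manifold ContDiff Topology
open Set Filter
open Literature.Geometry.Kaehler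

namespace Literature.AlgebraicGeometry.HodgeTheory

section Weights

variable {E : Type*} [NormedAddCommGroup E] [NormedSpace ℂ E]
  {M : Type*} [TopologicalSpace M] [ChartedSpace E M] {ι : Type*}

/-- The `0`-form `log h_i` of a Hermitian metric is smooth at the points of `U_i` (`h_i` is `C^∞`
and `> 0` there; Voisin (2002), §3.3.1). [cite: VoisinHodgeI2002, §3.3.1] -/
theorem smoothAt_ofFun_log_weight {L : HolomorphicLineBundle ι E M} (h : L.HermitianMetric)
    (i : ι) {x : M} (hx : x ∈ L.baseSet i) :
    (MForm.ofFun 𝓘(ℝ, E) fun x ↦ (Real.log (h.weight i x) : ℂ)).SmoothAt x := by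
  refine MForm.smoothAt_ofFun_of_contMDiffAt ?_
  have h1 : ContMDiffAt 𝓘(ℝ, E) 𝓘(ℝ, ℝ) ∞ (h.weight i) x :=
    (h.contMDiffOn_weight i).contMDiffAt ((L.isOpen_baseSet i).mem_nhds hx)
  have h2 : ContDiffAt ℝ ∞ (fun t : ℝ ↦ (Real.log t : ℂ)) (h.weight i x) :=
    Complex.ofRealCLM.contDiff.contDiffAt.comp _
      (Real.contDiffAt_log.2 (h.weight_pos i x hx).ne')
  exact h2.comp_contMDiffAt h1

end Weights

/-- **Discharge of `chernForm_exact_of_isTrivialOn`: the Chern form of a Hermitian holomorphic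
line bundle is exact on every open set over which the bundle is trivial.** With the non-vanishing
holomorphic section `s` of `L|_W`, `H = h(s) = h_i |s_i|²`, `ζ = (1/4π)(d log H) ∘ J` and
`η = ζ|_W`: `dη = θ|_W`, because on `U_j ∩ W` one has `log H = log h_j + log |s_j|²` with
`d((d log |s_j|²) ∘ J) = 0` (pluriharmonicity, `mextDeriv_compJ_mextDeriv_log_norm_sq_eq_zero`)
and `(1/4π) d((d log h_j) ∘ J) = θ` (`IsChernForm`). Voisin (2002), proof of Thm. 7.10
("`ω_{L,h|U_i} = dβ_i`") and proof of Thm. 11.33 ("`c₁(L_i)` vanishes on `X − D_i`, since `L_i` is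
trivial on `X − D_i`"; "`∂∂̄ log h = ∂∂̄ log h(σ)`"), with §3.3.1 ("`∂∂̄ log |g_ij|² = 0`").
[cite: VoisinHodgeI2002, Thm. 7.10 (proof) and Thm. 11.33 (proof)] -/
theorem chernForm_exact_of_isTrivialOn_holds : chernForm_exact_of_isTrivialOn := by
  intro E _ _ _ M _ _ _ ι L h θ hθs hθ W hW
  haveI : IsManifold 𝓘(ℝ, E) ∞ M := isManifold_real_of_isManifold_complex
  obtain ⟨s, hs, hs0, hsg⟩ := hW
  choose idx hidx using L.exists_mem_baseSet
  have hVo : ∀ j, IsOpen (L.baseSet j ∩ (W : Set M)) := fun j ↦ (L.isOpen_baseSet j).inter W.2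
  -- the squared length `H = h(s) = h_i |s_i|²` of the trivialising section (junk off `W`)
  set Fn : M → ℝ := fun x ↦ h.weight (idx x) x * ‖s (idx x) x‖ ^ 2 with hFn_def
  have hFn_eq : ∀ j, ∀ x ∈ L.baseSet j ∩ (W : Set M), Fn x = h.weight j x * ‖s j x‖ ^ 2 := by
    intro j x hx
    have h1 := hsg (idx x) j x ⟨⟨hidx x, hx.1⟩, hx.2⟩
    have h2 := h.weight_eq (idx x) j x ⟨hidx x, hx.1⟩
    rw [hFn_def]
    dsimp only
    rw [h2, h1, norm_mul]
    ring
  -- the potential `u = log H` and its local decomposition `u = log h_j + log |s_j|²` on `U_j ∩ W`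
  set u : M → ℂ := fun x ↦ (Real.log (Fn x) : ℂ) with hu_def
  set v : ι → M → ℂ := fun j x ↦ (Real.log (h.weight j x) : ℂ) with hv_def
  set w : ι → M → ℂ := fun j x ↦ (Real.log (‖s j x‖ ^ 2) : ℂ) with hw_def
  have hu_loc : ∀ j, ∀ x ∈ L.baseSet j ∩ (W : Set M), u x = v j x + w j x := by
    intro j x hx
    rw [hu_def, hv_def, hw_def]
    dsimp only
    rw [hFn_eq j x hx, Real.log_mul (h.weight_pos j x hx.1).ne'
      (pow_ne_zero 2 (norm_ne_zero_iff.2 (hs0 j x hx))), Complex.ofReal_add]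
  -- smoothness of the pieces
  have hv_smooth : ∀ j, ∀ x ∈ L.baseSet j, (MForm.ofFun 𝓘(ℝ, E) (v j)).SmoothAt x :=
    fun j x hx ↦ smoothAt_ofFun_log_weight h j hx
  have hw_smooth : ∀ j, ∀ x ∈ L.baseSet j ∩ (W : Set M),
      (MForm.ofFun 𝓘(ℝ, E) (w j)).SmoothAt x :=
    fun j x hx ↦ MForm.smoothAt_ofFun_of_contMDiffAt (contMDiffAt_ofReal_log_norm_sq
      (contMDiffAt_real_of_mdifferentiableOn_complex (hs j) (hVo j) hx) (hs0 j x hx))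
  have hu_ev : ∀ j, ∀ x ∈ L.baseSet j ∩ (W : Set M), ∀ᶠ y in 𝓝 x,
      (MForm.ofFun 𝓘(ℝ, E) (v j) + MForm.ofFun 𝓘(ℝ, E) (w j)) y = MForm.ofFun 𝓘(ℝ, E) u y := by
    intro j x hx
    filter_upwards [(hVo j).mem_nhds hx] with y hy
    ext t
    exact (hu_loc j y hy).symm
  have hu_smooth : ∀ x ∈ (W : Set M), (MForm.ofFun 𝓘(ℝ, E) u).SmoothAt x := fun x hx ↦
    ((hv_smooth (idx x) x (hidx x)).add (hw_smooth (idx x) x ⟨hidx x, hx⟩)).congr_of_eventuallyEq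
      (hu_ev (idx x) x ⟨hidx x, hx⟩)
  -- `d u = d v_j + d w_j` on `U_j ∩ W`
  have hdu : ∀ j, ∀ x ∈ L.baseSet j ∩ (W : Set M),
      mextDeriv (MForm.ofFun 𝓘(ℝ, E) u) x =
        mextDeriv (MForm.ofFun 𝓘(ℝ, E) (v j)) x + mextDeriv (MForm.ofFun 𝓘(ℝ, E) (w j)) x := by
    intro j x hx
    rw [← mextDeriv_add_apply (hv_smooth j x hx.1) (hw_smooth j x hx),
      mextDeriv_congr_of_eventuallyEq (hu_ev j x hx)]
  -- the primitive `ζ = (1/4π) (d u) ∘ J` on `M`, smooth at the points of `W`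
  set ζ : MForm 𝓘(ℝ, E) M ℂ 1 :=
    (1 / (4 * Real.pi)) • (mextDeriv (MForm.ofFun 𝓘(ℝ, E) u)).compJ with hζ_def
  have hζ_smooth : ∀ x ∈ (W : Set M), ζ.SmoothAt x := fun x hx ↦
    (MForm.SmoothAt.mextDeriv (Filter.eventually_of_mem (W.2.mem_nhds hx) hu_smooth)).compJ.smul _
  -- `d ζ = θ` on `W`
  have key : ∀ x ∈ (W : Set M), mextDeriv ζ x = θ x := by
    intro x hxW
    have hxV : x ∈ L.baseSet (idx x) ∩ (W : Set M) := ⟨hidx x, hxW⟩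
    rw [hθ (idx x) x (hidx x), HolomorphicLineBundle.HermitianMetric.localChernForm, hζ_def,
      mextDeriv_smul]
    change (1 / (4 * Real.pi)) • mextDeriv (mextDeriv (MForm.ofFun 𝓘(ℝ, E) u)).compJ x =
      (1 / (4 * Real.pi)) • mextDeriv (mextDeriv (MForm.ofFun 𝓘(ℝ, E) (v (idx x)))).compJ x
    congr 1
    have hev : ∀ᶠ y in 𝓝 x, (mextDeriv (MForm.ofFun 𝓘(ℝ, E) u)).compJ y =
        ((mextDeriv (MForm.ofFun 𝓘(ℝ, E) (v (idx x)))).compJ +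
          (mextDeriv (MForm.ofFun 𝓘(ℝ, E) (w (idx x)))).compJ) y := by
      filter_upwards [(hVo (idx x)).mem_nhds hxV] with y hy
      rw [← MForm.compJ_add]
      simp only [MForm.compJ, Pi.add_apply, hdu (idx x) y hy]
    have h1 : (mextDeriv (MForm.ofFun 𝓘(ℝ, E) (v (idx x)))).compJ.SmoothAt x :=
      (MForm.SmoothAt.mextDeriv (Filter.eventually_of_mem ((L.isOpen_baseSet _).mem_nhds (hidx x))
        (hv_smooth (idx x)))).compJ
    have h2 : (mextDeriv (MForm.ofFun 𝓘(ℝ, E) (w (idx x)))).compJ.SmoothAt x :=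
      (MForm.SmoothAt.mextDeriv (Filter.eventually_of_mem ((hVo _).mem_nhds hxV)
        (hw_smooth (idx x)))).compJ
    rw [mextDeriv_congr_of_eventuallyEq hev, mextDeriv_add_apply h1 h2,
      mextDeriv_compJ_mextDeriv_log_norm_sq_eq_zero (hs (idx x)) (hVo _) (hs0 (idx x)) hxV,
      add_zero]
  -- conclusion: `η = ζ|_W`, and `dη = (dζ)|_W = θ|_W`
  refine ⟨ζ.pullback 𝓘(ℝ, E) Subtype.val, fun x ↦ (hζ_smooth x x.2).pullback_subtypeVal, ?_⟩
  funext x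
  ext t
  rw [mextDeriv_pullback_subtypeVal_apply (hζ_smooth x x.2), MForm.pullback_subtypeVal_apply,
    key x x.2]

end Literature.AlgebraicGeometry.HodgeTheory
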